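import Literature.AlgebraicGeometry.Resolution.IsolatedOrderPointApproximate
import Literature.AlgebraicGeometry.Resolution.PowerSeriesRegularLocal
import Literature.AlgebraicGeometry.Hironaka2017.ARSchemeSingGluing
import Summits.ResolutionOfSingularities.ResolutionOfSingularities.Theorems.MarkedTransferCampaignW46MohWindowSurface
import Mathlib.RingTheory.Ideal.KrullsHeightTheorem
import HarnessLib

/-!
# [OURS · L1 W4.6 rung (iii-2)] THE APPROXIMATE EXIT DOOR: at an isolated singular point of the typed procedure NO ideal of a
# positive-dimensional germ — in `𝒪_{Z,ξ}`, in the completion, or in Cohen coordinates — carries `J_ξ` to order `b` beyond a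
# UNIFORM precision `N(ξ)`; in embedding dimension `3` no pair `(u, v)` does

Cell `res-hironaka`, LADDER-RESOLUTION rung L (D-0089), slot W4.6 rung (iii) «purely inseparable surface Moh window», seat
res-L1-s46-pv-5 (gen 6). Host route MarkedTransfer (`HypersurfaceOrderReduction`, stmt-ResolutionOfSingularities-16155),
`--supports … --as helper`; kind proof (no definition). ROUTE-INDEPENDENT (no `Theses/…` import).

WHY. Every termination argument of rung (iii-2) for `p ≥ 3` in the tree ends the same way: an infinite in-window walk has a STALL TAIL,
along which the equation becomes a formal `p`-th power of a smooth formal curve germ `(z′, y′ − ψ)`, and the COMPLETION exit door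
(res-D-pv-050 AS s46-pv-12, `…MohWindowSurfaceFormalExit.lean`: a non-maximal prime `𝔠 ⊂ 𝒪̂_ξ` with `J_ξ𝒪̂ ⊆ 𝔠^p`) contradicts
`Regime.isolatedSing`. That door needs the EXACT containment, i.e. the INFINITE tail (res-L1-s46-pv-6's `phase_of_walk` takes an argmin
over the whole walk and a formal-branch limit — the reason the power-series port could not proceed by truncation, HOME
L/res-L1-s46-pv-6/GENERAL-REGIME-ANALYSIS.md §2). THIS FILE REPLACES THE EXACT DOOR BY AN APPROXIMATE ONE: at a singular point `ξ` of a
stage with isolated singular locus there is a precision `N = N(ξ)` such that `J_ξ ⊆ 𝔞^b + 𝔪^N` already forces `𝔞` to be `𝔪`-primary —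
so a FINITE stall run of length `> N` (res-L1-s46-pv-6's finite-horizon digit formula `formal_pth_power_of_run_digits`: `k` stall steps
⇒ `F ≡ (y − ψ_k)^p·w mod deg o + k`) is impossible, with no limit and no completion prime. The tool is the tree's differential
order theory on smooth schemes over a PERFECT field (`Literature/…/IsolatedOrderPointApproximate.lean`, this seat, p544366 + v2:
`Diff^{≤ b−1}(J_ξ)` is `𝔪_ξ`-primary at an isolated point of `Sing(E)`, Leibniz, Nakayama; transfer along the dense map `𝒪 → 𝒪̂ ≅ K⟦X⟧`).

WHAT IS PROVED (`K` perfect throughout §2–§4; `A : AmbientDatum p K`, `E : IdealExponent A.Z`, `b = E.b > 0`)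
* §1 `not_le_idealOrder_of_specializes_of_sing_subset_closedPoints` — if `Sing(E)` consists of closed points (half of
  `Regime.isolatedSing`), no proper generization of any point has order `≥ b`: the isolation hypothesis of the library brick.
* §2 THE DOOR in `𝒪_{Z,ξ}`: `exists_pow_le_of_stalkIdeal_le_sup_pow` (∃ N, ∀ 𝔞, `J_ξ ⊆ 𝔞^b + 𝔪^{N+b} ⇒ 𝔪^N ⊆ 𝔞`),
  `exists_not_stalkIdeal_le_sup_pow_of_isPrime` (primes `≠ 𝔪`); in the COMPLETION and in COHEN COORDINATES `e : 𝒪̂_ξ ≅ T`: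
  `exists_pow_le_of_map_adicCompletion_le_sup_pow`, `exists_pow_le_of_map_ringEquiv_le_sup_pow`.
* §3 TWO GENERATORS NEVER SUFFICE in dimension `> 2`: `not_pow_maximalIdeal_le_span_pair` (Krull's height theorem, Mathlib
  `Ideal.height_le_card_of_mem_minimalPrimes_span_finset`), for regular local rings of embedding dimension `3`
  (`not_pow_maximalIdeal_le_span_pair_of_spanFinrank_eq_three`) and for `K⟦X⟧`, `|X| = 3` (`…_mvPowerSeries`).
* §4 THE DOOR IN o1's VOCABULARY: at a singular point of a stage in `Regime.mohWindowSurfaceIsolated` / `regimeMohWindowSurfaceInsep` /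
  `Regime.mohWindowSurface` (embedding dimension `3` from the window predicate) there is `N` with `J_ξ ⊄ (u, v)^b + 𝔪_ξ^N` for ALL
  `u, v ∈ 𝔪_ξ` (`MohWindowSurface.exists_forall_not_le_span_pair_pow_sup`, `…Insep…`, `…Coeff…`), and the same read in any Cohen
  coordinates `e : 𝒪̂_ξ ≅ K⟦z, u₀, u₁⟧` (`exists_forall_not_map_le_span_pair_pow_sup_mvPowerSeries`: `J_ξ·K⟦X⟧ ⊄ (g, h)^b + 𝔪^N` for all
  `g, h ∈ 𝔪`) — the shape `(z, y − ψ_k)^p + 𝔪^{o+k}` delivered by a finite stall run.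

HONEST FRAMING. Nothing here is a statement of H. Hironaka's manuscript [Hironaka2017] (2017-03-23; Th. 16.6 p.84, Th. 16.13 p.87 — scope
only, under adjudication) and nothing asserts that any statement of it holds; the regimes are OURS campaign definitions (res-L1-type-o1,
res-D-pv-050, res-L1-s46-pv-1). `K` PERFECT is used (differential order criterion at non-closed points fails over imperfect fields:
`y^p − t x^p` has all Hasse derivatives of order `< p` zero but order `1` at its own prime). AI-written; AI review is weaker than expert
review. No `sorry`; axioms standard. References: O. Villamayor U., Rev. Mat. Iberoam. 24 (2008) §4.1 [VillamayorU2008ReesDiff];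
V. Cossart, O. Piltant, J. Algebra 320 (2008) Prop. 4.4 [CossartPiltant2008]; Stacks Project Tags 01J7, 00DV, 05GG, 00KU [StacksProject].
-/

noncomputable section

set_option linter.dupNamespace false -- mandated namespace of this single-conjunct summit

open CategoryTheory AlgebraicGeometry TopologicalSpace IsLocalRing

namespace Summit.ResolutionOfSingularities.ResolutionOfSingularities.Theorems

namespace CampaignW46

open Literature.AlgebraicGeometry.Resolution
open Literature.AlgebraicGeometry.Hironaka2017.S02Preliminaries
open Literature.AlgebraicGeometry.Hironaka2017.Datum

universe u

variable {p : ℕ} [Fact p.Prime] {K : Type u} [Field K] [CharP K p]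

/-! ## §1 Isolation at a point from «`Sing(E)` consists of closed points» -/

/-- [OURS · L1 W4.6] If `Sing(E) ⊆ Z_cl` (half of `Regime.isolatedSing`), then no PROPER generization `ζ ⤳ ξ` of any point has
`ord_ζ J ≥ b`: such a `ζ` would be a closed point of `Sing(E)` specializing to `ξ ≠ ζ`. NOT a statement of the manuscript. [folklore] -/
theorem not_le_idealOrder_of_specializes_of_sing_subset_closedPoints {Z : Scheme.{u}} (E : IdealExponent Z)
    (hcl : E.sing ⊆ Literature.AlgebraicGeometry.Hironaka2017.S02Preliminaries.closedPoints Z) {ζ ξ : Z} (hζ : ζ ⤳ ξ) (hne : ζ ≠ ξ) : ¬ ((E.b : ℕ∞) ≤ idealOrder E.J ζ) := by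
  intro hord
  have hc : IsClosed ({ζ} : Set Z) := hcl hord
  have hmem : ξ ∈ closure ({ζ} : Set Z) := specializes_iff_mem_closure.mp hζ
  rw [hc.closure_eq, Set.mem_singleton_iff] at hmem
  exact hne hmem.symm

/-! ## §2 The approximate exit door at a point of a stage with isolated singular locus -/

section Door

variable [PerfectField K]

/-- [OURS · L1 W4.6 rung (iii-2)] **THE APPROXIMATE EXIT DOOR in `𝒪_{Z,ξ}`** — replaces the role of the completion exit door
(`…MohWindowSurfaceFormalExit.not_isolatedSing_of_map_adicCompletion_le_pow`) for FINITE precision; NOT a statement of the manuscript: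
`K` perfect, `Sing(E) ⊆ Z_cl`, `b = E.b > 0`; at EVERY point `ξ` there is `N` such that for every ideal `𝔞 ⊆ 𝒪_{Z,ξ}`,
`J_ξ ⊆ 𝔞^b + 𝔪_ξ^{N+b}` forces `𝔪_ξ^N ⊆ 𝔞`. [folklore] -/
theorem exists_pow_le_of_stalkIdeal_le_sup_pow (A : AmbientDatum p K) (E : IdealExponent A.Z) (hcl : E.sing ⊆ Literature.AlgebraicGeometry.Hironaka2017.S02Preliminaries.closedPoints A.Z)
    (hb : 0 < E.b) (ξ : A.Z) :
    ∃ N : ℕ, ∀ 𝔞 : Ideal (A.Z.presheaf.stalk ξ),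
      stalkIdeal E.J ξ ≤ 𝔞 ^ E.b ⊔ maximalIdeal (A.Z.presheaf.stalk ξ) ^ (N + E.b) →
        maximalIdeal (A.Z.presheaf.stalk ξ) ^ N ≤ 𝔞 := by
  haveI := A.smooth
  haveI : IsNoetherian A.Z := A.isNoetherian_ambient
  haveI : IsIntegral A.Z := A.isIntegral_ambient
  have hisol : ∀ ζ : A.Z, ζ ⤳ ξ → ζ ≠ ξ → ¬ (((E.b - 1 + 1 : ℕ) : ℕ∞) ≤ idealOrder E.J ζ) := fun ζ hζ hne => by
    rw [Nat.sub_add_cancel hb]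
    exact not_le_idealOrder_of_specializes_of_sing_subset_closedPoints E hcl hζ hne
  obtain ⟨N, hN⟩ := exists_pow_le_of_le_sup_pow_of_isolated A.hom E.J hisol
  refine ⟨N, fun 𝔞 h => hN 𝔞 ?_⟩
  have heq : N + (E.b - 1) + 1 = N + E.b := by omega
  rw [heq, Nat.sub_add_cancel hb]
  exact h

/-- [OURS · L1 W4.6 rung (iii-2)] **No approximate `b`-fold structure along a non-maximal prime** (the germ of a curve or a surface
through `ξ`): with `N` as above, `J_ξ ⊄ 𝔮^b + 𝔪_ξ^{N+b}` for every prime `𝔮 ≠ 𝔪_ξ`. NOT a statement of the manuscript. [folklore] -/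
theorem exists_not_stalkIdeal_le_sup_pow_of_isPrime (A : AmbientDatum p K) (E : IdealExponent A.Z)
    (hcl : E.sing ⊆ Literature.AlgebraicGeometry.Hironaka2017.S02Preliminaries.closedPoints A.Z) (hb : 0 < E.b) (ξ : A.Z) :
    ∃ N : ℕ, ∀ 𝔮 : Ideal (A.Z.presheaf.stalk ξ), 𝔮.IsPrime → 𝔮 ≠ maximalIdeal (A.Z.presheaf.stalk ξ) →
      ¬ stalkIdeal E.J ξ ≤ 𝔮 ^ E.b ⊔ maximalIdeal (A.Z.presheaf.stalk ξ) ^ (N + E.b) := by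
  obtain ⟨N, hN⟩ := exists_pow_le_of_stalkIdeal_le_sup_pow A E hcl hb ξ
  refine ⟨N, fun 𝔮 h𝔮 hne hle => hne ?_⟩
  have hm𝔮 : maximalIdeal (A.Z.presheaf.stalk ξ) ≤ 𝔮 :=
    fun r hr => h𝔮.mem_of_pow_mem N (hN 𝔮 hle (Ideal.pow_mem_pow hr N))
  exact (IsLocalRing.le_maximalIdeal h𝔮.ne_top).antisymm hm𝔮

/-- [OURS · L1 W4.6 rung (iii-2)] **The door in the completion `𝒪̂_{Z,ξ}`**: `J_ξ 𝒪̂ ⊆ 𝔞^b + 𝔪̂^{N+b} ⇒ 𝔪̂^N ⊆ 𝔞` for every ideal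
`𝔞 ⊆ 𝒪̂_{Z,ξ}` (density + faithfulness of the `𝔪`-adic filtration, tree `pow_le_of_map_adicCompletion_le_sup_pow`). NOT a statement
of the manuscript. [folklore] -/
theorem exists_pow_le_of_map_adicCompletion_le_sup_pow (A : AmbientDatum p K) (E : IdealExponent A.Z)
    (hcl : E.sing ⊆ Literature.AlgebraicGeometry.Hironaka2017.S02Preliminaries.closedPoints A.Z) (hb : 0 < E.b) (ξ : A.Z) :
    ∃ N : ℕ, ∀ 𝔞 : Ideal (AdicCompletion (maximalIdeal (A.Z.presheaf.stalk ξ)) (A.Z.presheaf.stalk ξ)),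
      (stalkIdeal E.J ξ).map (algebraMap (A.Z.presheaf.stalk ξ)
          (AdicCompletion (maximalIdeal (A.Z.presheaf.stalk ξ)) (A.Z.presheaf.stalk ξ))) ≤
        𝔞 ^ E.b ⊔ (maximalIdeal (A.Z.presheaf.stalk ξ) ^ (N + E.b)).map (algebraMap (A.Z.presheaf.stalk ξ)
          (AdicCompletion (maximalIdeal (A.Z.presheaf.stalk ξ)) (A.Z.presheaf.stalk ξ))) →
      (maximalIdeal (A.Z.presheaf.stalk ξ) ^ N).map (algebraMap (A.Z.presheaf.stalk ξ)
          (AdicCompletion (maximalIdeal (A.Z.presheaf.stalk ξ)) (A.Z.presheaf.stalk ξ))) ≤ 𝔞 := by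
  haveI := A.smooth
  haveI : IsLocallyNoetherian A.Z := LocallyOfFiniteType.isLocallyNoetherian A.hom
  obtain ⟨N, hN⟩ := exists_pow_le_of_stalkIdeal_le_sup_pow A E hcl hb ξ
  refine ⟨N, fun 𝔞 h => ?_⟩
  have hmap : ∀ n, (maximalIdeal (A.Z.presheaf.stalk ξ) ^ n).map (algebraMap (A.Z.presheaf.stalk ξ)
      (AdicCompletion (maximalIdeal (A.Z.presheaf.stalk ξ)) (A.Z.presheaf.stalk ξ))) = maximalIdeal _ ^ n := fun n => by
    rw [Ideal.map_pow, ← AdicCompletion.maximalIdeal_eq_map]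
  rw [hmap] at h ⊢
  exact pow_le_of_map_adicCompletion_le_sup_pow hb hN h

/-- [OURS · L1 W4.6 rung (iii-2)] **The door in Cohen coordinates `e : 𝒪̂_{Z,ξ} ≅ T`** (`T` any local ring, e.g. `K⟦z, u₀, u₁⟧`;
the map is `e ∘ (𝒪 → 𝒪̂)` as in res-L1-s46-pv-6's formal anchors): `J_ξ·T ⊆ 𝔞^b + 𝔪_T^{N+b} ⇒ 𝔪_T^N ⊆ 𝔞` for every ideal `𝔞 ⊆ T`.
NOT a statement of the manuscript. [folklore] -/
theorem exists_pow_le_of_map_ringEquiv_le_sup_pow (A : AmbientDatum p K) (E : IdealExponent A.Z)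
    (hcl : E.sing ⊆ Literature.AlgebraicGeometry.Hironaka2017.S02Preliminaries.closedPoints A.Z) (hb : 0 < E.b) (ξ : A.Z) {T : Type*} [CommRing T] [IsLocalRing T]
    (e : AdicCompletion (maximalIdeal (A.Z.presheaf.stalk ξ)) (A.Z.presheaf.stalk ξ) ≃+* T) :
    ∃ N : ℕ, ∀ 𝔞 : Ideal T,
      (stalkIdeal E.J ξ).map ((e : _ →+* T).comp (algebraMap (A.Z.presheaf.stalk ξ)
          (AdicCompletion (maximalIdeal (A.Z.presheaf.stalk ξ)) (A.Z.presheaf.stalk ξ)))) ≤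
        𝔞 ^ E.b ⊔ maximalIdeal T ^ (N + E.b) → maximalIdeal T ^ N ≤ 𝔞 := by
  haveI := A.smooth
  haveI : IsLocallyNoetherian A.Z := LocallyOfFiniteType.isLocallyNoetherian A.hom
  obtain ⟨N, hN⟩ := exists_pow_le_of_stalkIdeal_le_sup_pow A E hcl hb ξ
  exact ⟨N, fun 𝔞 h => pow_le_of_map_ringEquiv_adicCompletion_le_sup_pow e hb hN h⟩

end Door

/-! ## §3 Two generators never carry a power of `𝔪` in dimension `> 2` -/

/-- **Krull's height theorem, the form used here**: in a Noetherian local ring whose maximal ideal has height `> 2` (dimension `> 2`),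
no power of the maximal ideal lies in an ideal generated by two non-units (`𝔪` would be minimal over `(u, v)`, of height `≤ 2`).
[folklore] -/
theorem not_pow_maximalIdeal_le_span_pair {R : Type*} [CommRing R] [IsLocalRing R] [IsNoetherianRing R]
    (hdim : 2 < (maximalIdeal R).height) {u v : R} (hu : u ∈ maximalIdeal R) (hv : v ∈ maximalIdeal R) (N : ℕ) :
    ¬ maximalIdeal R ^ N ≤ Ideal.span {u, v} := by
  classical
  intro h
  have hle : Ideal.span {u, v} ≤ maximalIdeal R := by
    rw [Ideal.span_le]
    rintro x (rfl | rfl)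
    · exact hu
    · exact hv
  have hmin : maximalIdeal R ∈ (Ideal.span ({u, v} : Set R)).minimalPrimes := by
    refine ⟨⟨inferInstance, hle⟩, fun q ⟨hq, hq'⟩ _ => ?_⟩
    exact fun r hr => hq.mem_of_pow_mem N (hq' (h (Ideal.pow_mem_pow hr N)))
  have hs : (({u, v} : Finset R) : Set R) = {u, v} := by simp
  rw [← hs] at hmin
  have hheight := Ideal.height_le_card_of_mem_minimalPrimes_span_finset hmin
  have hcard : (({u, v} : Finset R).card : ℕ∞) ≤ 2 := by exact_mod_cast Finset.card_le_two
  exact absurd (hheight.trans hcard) (not_le.mpr hdim)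

/-- The same for a regular local ring of embedding dimension `3` (the stalks of o1's surface window regimes). [folklore] -/
theorem not_pow_maximalIdeal_le_span_pair_of_spanFinrank_eq_three {R : Type*} [CommRing R] [IsRegularLocalRing R]
    (h3 : (maximalIdeal R).spanFinrank = 3) {u v : R} (hu : u ∈ maximalIdeal R) (hv : v ∈ maximalIdeal R) (N : ℕ) :
    ¬ maximalIdeal R ^ N ≤ Ideal.span {u, v} := by
  refine not_pow_maximalIdeal_le_span_pair ?_ hu hv N
  have h1 : ((maximalIdeal R).height : WithBot ℕ∞) = ((3 : ℕ) : WithBot ℕ∞) := by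
    rw [IsLocalRing.maximalIdeal_height_eq_ringKrullDim, ← IsRegularLocalRing.spanFinrank_maximalIdeal, h3]
  have h2 : (maximalIdeal R).height = (3 : ℕ) := by
    rw [← WithBot.coe_natCast] at h1
    exact WithBot.coe_injective h1
  rw [h2]
  exact_mod_cast (by norm_num : (2 : ℕ) < 3)

/-- The same for `K⟦X⟧` with three variables (`Option (Fin 2)`, res-L1-s46-pv-6's frame `z = X none`, `u_l = X (some l)`): dimension
`3` by the tree's `ringKrullDim_mvPowerSeries`. [folklore] -/
theorem not_pow_maximalIdeal_le_span_pair_mvPowerSeries {k : Type u} [Field k] {g h : MvPowerSeries (Option (Fin 2)) k}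
    (hg : g ∈ maximalIdeal (MvPowerSeries (Option (Fin 2)) k)) (hh : h ∈ maximalIdeal (MvPowerSeries (Option (Fin 2)) k)) (N : ℕ) :
    ¬ maximalIdeal (MvPowerSeries (Option (Fin 2)) k) ^ N ≤ Ideal.span {g, h} := by
  haveI : IsRegularLocalRing (MvPowerSeries (Option (Fin 2)) k) := isRegularLocalRing_mvPowerSeries k (Option (Fin 2))
  refine not_pow_maximalIdeal_le_span_pair ?_ hg hh N
  have hcard : Nat.card (Option (Fin 2)) = 3 := by simp
  have h1 : ((maximalIdeal (MvPowerSeries (Option (Fin 2)) k)).height : WithBot ℕ∞) = ((3 : ℕ) : WithBot ℕ∞) := by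
    rw [IsLocalRing.maximalIdeal_height_eq_ringKrullDim, ringKrullDim_mvPowerSeries k (Option (Fin 2)), hcard]
  have h2 : (maximalIdeal (MvPowerSeries (Option (Fin 2)) k)).height = (3 : ℕ) := by
    rw [← WithBot.coe_natCast] at h1
    exact WithBot.coe_injective h1
  rw [h2]
  exact_mod_cast (by norm_num : (2 : ℕ) < 3)

/-! ## §4 The door in o1's vocabulary: no pair `(u, v)` carries `J_ξ` to order `b` beyond precision `N` -/

section Window

variable [PerfectField K]

/-- [OURS · L1 W4.6 rung (iii-2)] **Generic two-generator door**: `K` perfect, `Sing(E) ⊆ Z_cl`, `b > 0`, and the stalk at `ξ` regular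
of embedding dimension `3`; then there is `N` with `J_ξ ⊄ (u, v)^b + 𝔪_ξ^N` for ALL `u, v ∈ 𝔪_ξ` — no smooth or singular curve germ
`{u = v = 0}` through `ξ` is approximately `b`-fold for `J_ξ` beyond precision `N`. NOT a statement of the manuscript. [folklore] -/
theorem exists_forall_not_le_span_pair_pow_sup (A : AmbientDatum p K) (E : IdealExponent A.Z) (hcl : E.sing ⊆ Literature.AlgebraicGeometry.Hironaka2017.S02Preliminaries.closedPoints A.Z)
    (hb : 0 < E.b) (ξ : A.Z) (hreg : IsRegularLocalRing (A.Z.presheaf.stalk ξ))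
    (h3 : (maximalIdeal (A.Z.presheaf.stalk ξ)).spanFinrank = 3) :
    ∃ N : ℕ, ∀ u v : A.Z.presheaf.stalk ξ, u ∈ maximalIdeal _ → v ∈ maximalIdeal _ →
      ¬ stalkIdeal E.J ξ ≤ Ideal.span {u, v} ^ E.b ⊔ maximalIdeal (A.Z.presheaf.stalk ξ) ^ N := by
  haveI := hreg
  obtain ⟨N, hN⟩ := exists_pow_le_of_stalkIdeal_le_sup_pow A E hcl hb ξ
  exact ⟨N + E.b, fun u v hu hv hle =>
    not_pow_maximalIdeal_le_span_pair_of_spanFinrank_eq_three h3 hu hv N (hN _ hle)⟩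

/-- [OURS · L1 W4.6 rung (iii-2)] **The door at a singular point of `Regime.mohWindowSurfaceIsolated`** (o1 p498940 §2): there is `N`
with `J_ξ ⊄ (u, v)^b + 𝔪_ξ^N` for all `u, v ∈ 𝔪_ξ`. NOT a statement of the manuscript. [folklore] -/
theorem MohWindowSurface.exists_forall_not_le_span_pair_pow_sup_of_isolated (A : AmbientDatum p K) (E : IdealExponent A.Z)
    (hRg : Regime.mohWindowSurfaceIsolated A E) (hb : 0 < E.b) {ξ : A.Z} (hξ : ξ ∈ E.sing) :
    ∃ N : ℕ, ∀ u v : A.Z.presheaf.stalk ξ, u ∈ maximalIdeal _ → v ∈ maximalIdeal _ →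
      ¬ stalkIdeal E.J ξ ≤ Ideal.span {u, v} ^ E.b ⊔ maximalIdeal (A.Z.presheaf.stalk ξ) ^ N := by
  obtain ⟨hreg, h3, -⟩ := hRg.2 ξ hξ
  exact exists_forall_not_le_span_pair_pow_sup A E hRg.1.2 hb ξ hreg h3

/-- [OURS · L1 W4.6 rung (iii-2)] **The door at a singular point of o1's regime of record `regimeMohWindowSurfaceInsep`** (`b = p`):
there is `N` with `J_ξ ⊄ (u, v)^p + 𝔪_ξ^N` for all `u, v ∈ 𝔪_ξ`. NOT a statement of the manuscript. [folklore] -/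
theorem MohWindowSurface.exists_forall_not_le_span_pair_pow_sup_of_insep (A : AmbientDatum p K) (E : IdealExponent A.Z)
    (hRg : regimeMohWindowSurfaceInsep A E) {ξ : A.Z} (hξ : ξ ∈ E.sing) :
    ∃ N : ℕ, ∀ u v : A.Z.presheaf.stalk ξ, u ∈ maximalIdeal _ → v ∈ maximalIdeal _ →
      ¬ stalkIdeal E.J ξ ≤ Ideal.span {u, v} ^ p ⊔ maximalIdeal (A.Z.presheaf.stalk ξ) ^ N := by
  have hb : E.b = p := hRg.2
  have h := MohWindowSurface.exists_forall_not_le_span_pair_pow_sup_of_isolated A E hRg.1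
    (by rw [hb]; exact (Fact.out : p.Prime).pos) hξ
  rw [hb] at h
  exact h

/-- [OURS · L1 W4.6 rung (iii-2)] **The door at a singular point of the coefficient regime `Regime.mohWindowSurface`** (res-D-pv-050's
§5 of o1's file; the regime of this seat's thread theorems `PermissibleRun.exists_stalling_thread_origin` &c.): there is `N` with
`J_ξ ⊄ (u, v)^p + 𝔪_ξ^N` for all `u, v ∈ 𝔪_ξ`. NOT a statement of the manuscript. [folklore] -/
theorem MohWindowSurface.exists_forall_not_le_span_pair_pow_sup_of_coeff (A : AmbientDatum p K) (E : IdealExponent A.Z)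
    (hRg : Regime.mohWindowSurface A E) {ξ : A.Z} (hξ : ξ ∈ E.sing) :
    ∃ N : ℕ, ∀ u v : A.Z.presheaf.stalk ξ, u ∈ maximalIdeal _ → v ∈ maximalIdeal _ →
      ¬ stalkIdeal E.J ξ ≤ Ideal.span {u, v} ^ p ⊔ maximalIdeal (A.Z.presheaf.stalk ξ) ^ N := by
  obtain ⟨hb, -, hcl, hwin⟩ := hRg
  obtain ⟨hreg, h3, -⟩ := hwin ξ hξ
  have h := exists_forall_not_le_span_pair_pow_sup A E hcl (by rw [hb]; exact (Fact.out : p.Prime).pos) ξ hreg h3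
  rw [hb] at h
  exact h

/-- [OURS · L1 W4.6 rung (iii-2)] **The door read in Cohen coordinates `e : 𝒪̂_{Z,ξ} ≅ K'⟦z, u₀, u₁⟧`** (any field `K'`, e.g. `K`
itself at a rational point, frame `Option (Fin 2)` as in res-L1-s46-pv-6's formal anchors): `K` perfect, `Sing(E) ⊆ Z_cl`, `b > 0`;
there is `N` such that `J_ξ·K'⟦X⟧ ⊄ (g, h)^b + 𝔪^N` for ALL `g, h ∈ 𝔪_{K'⟦X⟧}` — in particular for `(g, h) = (z′, y − ψ_k(x))`, the shape
a finite stall run of length `k` delivers with precision `o + k`. So a stall run from `ξ` has length `< N − o`. NOT a statement of the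
manuscript. [folklore] -/
theorem exists_forall_not_map_le_span_pair_pow_sup_mvPowerSeries (A : AmbientDatum p K) (E : IdealExponent A.Z)
    (hcl : E.sing ⊆ Literature.AlgebraicGeometry.Hironaka2017.S02Preliminaries.closedPoints A.Z) (hb : 0 < E.b) (ξ : A.Z) {K' : Type u} [Field K']
    (e : AdicCompletion (maximalIdeal (A.Z.presheaf.stalk ξ)) (A.Z.presheaf.stalk ξ) ≃+* MvPowerSeries (Option (Fin 2)) K') :
    ∃ N : ℕ, ∀ g h : MvPowerSeries (Option (Fin 2)) K', g ∈ maximalIdeal _ → h ∈ maximalIdeal _ →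
      ¬ (stalkIdeal E.J ξ).map ((e : _ →+* MvPowerSeries (Option (Fin 2)) K').comp
            (algebraMap (A.Z.presheaf.stalk ξ) (AdicCompletion (maximalIdeal (A.Z.presheaf.stalk ξ)) (A.Z.presheaf.stalk ξ)))) ≤
          Ideal.span {g, h} ^ E.b ⊔ maximalIdeal (MvPowerSeries (Option (Fin 2)) K') ^ N := by
  obtain ⟨N, hN⟩ := exists_pow_le_of_map_ringEquiv_le_sup_pow A E hcl hb ξ e
  exact ⟨N + E.b, fun g h hg hh hle => not_pow_maximalIdeal_le_span_pair_mvPowerSeries hg hh N (hN _ hle)⟩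

/-- [OURS · L1 W4.6 rung (iii-2)] The Cohen-coordinate door at a singular point of o1's regime of record `regimeMohWindowSurfaceInsep`
(`b = p`). NOT a statement of the manuscript. [folklore] -/
theorem MohWindowSurface.exists_forall_not_map_le_span_pair_pow_sup_of_insep (A : AmbientDatum p K) (E : IdealExponent A.Z)
    (hRg : regimeMohWindowSurfaceInsep A E) (ξ : A.Z) {K' : Type u} [Field K']
    (e : AdicCompletion (maximalIdeal (A.Z.presheaf.stalk ξ)) (A.Z.presheaf.stalk ξ) ≃+* MvPowerSeries (Option (Fin 2)) K') :
    ∃ N : ℕ, ∀ g h : MvPowerSeries (Option (Fin 2)) K', g ∈ maximalIdeal _ → h ∈ maximalIdeal _ →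
      ¬ (stalkIdeal E.J ξ).map ((e : _ →+* MvPowerSeries (Option (Fin 2)) K').comp
            (algebraMap (A.Z.presheaf.stalk ξ) (AdicCompletion (maximalIdeal (A.Z.presheaf.stalk ξ)) (A.Z.presheaf.stalk ξ)))) ≤
          Ideal.span {g, h} ^ p ⊔ maximalIdeal (MvPowerSeries (Option (Fin 2)) K') ^ N := by
  have hb : E.b = p := hRg.2
  have h := exists_forall_not_map_le_span_pair_pow_sup_mvPowerSeries A E hRg.1.1.2
    (by rw [hb]; exact (Fact.out : p.Prime).pos) ξ e
  rw [hb] at h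
  exact h

end Window

end CampaignW46

end Summit.ResolutionOfSingularities.ResolutionOfSingularities.Theorems

end
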